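import Summits.PneNP.PneNP.Theorems.SymmetryBudgetNoHiddenOrderPerPathCGAdm
import Summits.PneNP.PneNP.Theorems.SymmetryBudgetNoHiddenOrderWindowSetCard

/-!
# `NoHiddenOrder` (stmt-PneNP-14781): the LABEL INDEX SETS of the compiler and their polynomial size

Route `PneNP/SymmetryBudget`; continues `…PerPathCGCount.lean` / `…PerPathCGAdm.lean` (admissibility `AdmB B X λ`, the cover
`budgetCover V B` of size `2^{O(|V| + B)}`) and `…WindowSetCard.lean` (`|windowSet m| = ⌊log₂ m⌋`, `2^{c|W|} ≤ m^c`).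
The symmetric compilation of the certified-label scheme has one gate group per LABEL `(U, X, λ)`; this file provides the finite
index sets of labels, for both shapes of the compiler, with membership of every admissible label and a size polynomial in `m`:

* process on the window TYPE (`V` the vertex type, all labels): `admLabels B` — every label with `AdmB B X λ` is a member
  (`mem_admLabels`), `|admLabels B| ≤ 2^{|V|} · 2^{|V|} · (B+1) · 2^{|V|+B} · 2^B` (`card_admLabels_le`);
* process on `Fin m` from the start block `W`: `windowLabels W B` — every label with `U, X ⊆ W` and `AdmB B X λ` is a member
  (`mem_windowLabels`; along the solution subtree `U, X ⊆ W` by `reach_subset_block` of `…PerPathCGBudgetWindow.lean`), of size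
  `≤ 2^{|W|} · 2^{|W|} · (B+1) · 2^{|W|+B} · 2^B` (`card_windowLabels_le`, through the restriction to `↥W`);
* at the budget `B = 4n + ⌊log₂ n⌋`, `n` the window size, both bounds are `≤ 2^{18 n}` (`labelBound_le_two_pow`), i.e. `≤ m^18` for the
  window `windowSet m` (`card_windowLabels_windowSet_le`, `card_admLabels_windowSet_le`).
Sorry-free; supports stmt-PneNP-14781, does not close it.
-/

set_option linter.dupNamespace false -- `Summit.PneNP.PneNP.…` (D-0017 single-conjunct layout)

namespace Summit.PneNP.PneNP.Theorems

open Finset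

namespace BranchSum

variable {V : Type*} [Fintype V] [DecidableEq V]

/-- Labels have decidable equality (blocks, named sets and value functions on a finite type). -/
instance instDecidableEqLabel : DecidableEq (CertifiedLabels.Label V) := fun a b =>
  decidable_of_iff (a.U = b.U ∧ a.X = b.X ∧ a.lam = b.lam)
    ⟨fun h => by obtain ⟨U, X, lam⟩ := a; obtain ⟨U', X', lam'⟩ := b; obtain ⟨h1, h2, h3⟩ := h; simp only at h1 h2 h3; subst h1 h2 h3; rfl,
      fun h => h ▸ ⟨rfl, rfl, rfl⟩⟩

/-! ### All admissible labels (process on the window type) -/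

/-- **The admissible labels at budget `B`** as a finite set: `U` any block, `(X, λ)` from the cover. -/
noncomputable def admLabels (B : ℕ) : Finset (CertifiedLabels.Label V) :=
  ((univ : Finset V).powerset ×ˢ budgetCover V B).image fun q => ⟨q.1, q.2.1, q.2.2⟩

/-- **Every admissible label is a member.** -/
theorem mem_admLabels {B : ℕ} {L : CertifiedLabels.Label V} (h : AdmB B L.X L.lam) : L ∈ admLabels B := by
  unfold admLabels
  rw [mem_image]
  refine ⟨(L.U, (L.X, L.lam)), mem_product.2 ⟨mem_powerset.2 (subset_univ _), mem_budgetCover_of_admB V h⟩, ?_⟩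
  cases L
  rfl

/-- **Size of the admissible labels**: `≤ 2^{|V|} · (2^{|V|} · ((B+1) · 2^{|V|+B}) · 2^B)`. -/
theorem card_admLabels_le (B : ℕ) :
    (admLabels (V := V) B).card ≤ 2 ^ Fintype.card V * (2 ^ Fintype.card V * ((B + 1) * 2 ^ (Fintype.card V + B)) * 2 ^ B) := by
  unfold admLabels
  refine card_image_le.trans ?_
  rw [card_product, card_powerset, card_univ]
  exact Nat.mul_le_mul_left _ (card_budgetCover_le B)

/-! ### Labels inside a start block (process on `Fin m` from the window) -/

/-- Extension by zero of a function on the window type. -/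
def extendFun (W : Finset V) (f : ↥W → ℕ) (v : V) : ℕ := if h : v ∈ W then f ⟨v, h⟩ else 0

/-- **The window labels at budget `B`**: `U ⊆ W`, and `(X, λ)` the extension of a covered pair of the window type `↥W`. -/
noncomputable def windowLabels (W : Finset V) (B : ℕ) : Finset (CertifiedLabels.Label V) :=
  (W.powerset ×ˢ budgetCover ↥W B).image fun q => ⟨q.1, q.2.1.map (Function.Embedding.subtype _), extendFun W q.2.2⟩

omit [Fintype V] in
/-- Restricting an admissible pair supported in `W` to the window type keeps it admissible. -/
theorem admB_restrict {W : Finset V} {B : ℕ} {X : Finset V} {lam : V → ℕ} (hX : X ⊆ W) (h : AdmB B X lam) :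
    AdmB (V := ↥W) B (X.subtype (· ∈ W)) (lam ∘ Subtype.val) := by
  refine ⟨fun y hy => h.1 y (fun hyX => hy (mem_subtype.2 hyX)), ?_⟩
  have hmap : ∑ y ∈ X.subtype (· ∈ W), Nat.log 2 ((lam ∘ Subtype.val) y + 1) =
      ∑ y ∈ (X.subtype (· ∈ W)).map (Function.Embedding.subtype _), Nat.log 2 (lam y + 1) := by
    rw [sum_map]
    rfl
  rw [hmap, subtype_map, filter_true_of_mem fun y hy => hX hy]
  exact h.2

/-- **Every admissible label inside the window is a member.** -/
theorem mem_windowLabels {W : Finset V} {B : ℕ} {L : CertifiedLabels.Label V} (hU : L.U ⊆ W) (hX : L.X ⊆ W) (h : AdmB B L.X L.lam) :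
    L ∈ windowLabels W B := by
  unfold windowLabels
  rw [mem_image]
  refine ⟨(L.U, (L.X.subtype (· ∈ W), L.lam ∘ Subtype.val)),
    mem_product.2 ⟨mem_powerset.2 hU, mem_budgetCover_of_admB (↥W) (admB_restrict hX h)⟩, ?_⟩
  obtain ⟨U, X, lam⟩ := L
  simp only at hU hX h ⊢
  congr 1
  · rw [subtype_map, filter_true_of_mem fun y hy => hX hy]
  · funext v
    by_cases hv : v ∈ W
    · simp [extendFun, hv]
    · rw [h.1 v (fun hvX => hv (hX hvX))]
      simp [extendFun, hv]

/-- **Size of the window labels**: `≤ 2^{|W|} · (2^{|W|} · ((B+1) · 2^{|W|+B}) · 2^B)`. -/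
theorem card_windowLabels_le (W : Finset V) (B : ℕ) :
    (windowLabels W B).card ≤ 2 ^ W.card * (2 ^ W.card * ((B + 1) * 2 ^ (W.card + B)) * 2 ^ B) := by
  unfold windowLabels
  refine card_image_le.trans ?_
  rw [card_product, card_powerset]
  have := card_budgetCover_le (V := ↥W) B
  rw [Fintype.card_coe] at this
  exact Nat.mul_le_mul_left _ this

/-! ### The numeric bound at the window budget -/

/-- **The label bound at the window budget `B = 4n + ⌊log₂ n⌋` is `≤ 2^{18 n}`.** -/
theorem labelBound_le_two_pow (n : ℕ) :
    2 ^ n * (2 ^ n * ((4 * n + Nat.log 2 n + 1) * 2 ^ (n + (4 * n + Nat.log 2 n))) * 2 ^ (4 * n + Nat.log 2 n)) ≤ 2 ^ (18 * n) := by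
  set B := 4 * n + Nat.log 2 n with hB
  -- `⌊log₂ n⌋ ≤ n`, so `B ≤ 5n`
  have hL : Nat.log 2 n ≤ n := by
    rcases Nat.eq_zero_or_pos n with h0 | hn
    · rw [h0, Nat.log_zero_right]
    · exact (Nat.log_lt_self 2 hn.ne').le
  have hB5 : B ≤ 5 * n := by omega
  -- `B + 1 ≤ 2^B`
  have hsucc : ∀ k : ℕ, k + 1 ≤ 2 ^ k := fun k => by
    induction k with
    | zero => simp
    | succ k ih => rw [pow_succ]; omega
  have h1 : 2 ^ n * (2 ^ n * ((B + 1) * 2 ^ (n + B)) * 2 ^ B) ≤ 2 ^ n * (2 ^ n * (2 ^ B * 2 ^ (n + B)) * 2 ^ B) := by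
    have := hsucc B
    gcongr
  have h2 : 2 ^ n * (2 ^ n * (2 ^ B * 2 ^ (n + B)) * 2 ^ B) = 2 ^ (n + n + B + (n + B) + B) := by
    simp only [pow_add]; ring
  rw [h2] at h1
  exact h1.trans (Nat.pow_le_pow_right (by norm_num) (by omega))

/-- **The window labels of `windowSet m` at the window budget number at most `m^18`** (`m ≥ 1`). -/
theorem card_windowLabels_windowSet_le {m : ℕ} (hm : 0 < m) :
    (windowLabels (windowSet m) (4 * (windowSet m).card + Nat.log 2 (windowSet m).card)).card ≤ m ^ 18 :=
  ((card_windowLabels_le _ _).trans (labelBound_le_two_pow _)).trans (two_pow_mul_card_windowSet_le hm 18)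

/-- **The admissible labels of the window TYPE `↥(windowSet m)` at the window budget number at most `m^18`** (`m ≥ 1`). -/
theorem card_admLabels_windowSet_le {m : ℕ} (hm : 0 < m) :
    (admLabels (V := ↥(windowSet m))
        (4 * Fintype.card ↥(windowSet m) + Nat.log 2 (Fintype.card ↥(windowSet m)))).card ≤ m ^ 18 := by
  refine (card_admLabels_le _).trans ?_
  rw [Fintype.card_coe]
  exact (labelBound_le_two_pow _).trans (two_pow_mul_card_windowSet_le hm 18)

end BranchSum

end Summit.PneNP.PneNP.Theorems
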